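import Mathlib
import Summits.Ventures.PercRepro2.Defs
import Summits.Ventures.PercRepro2.Graph
import Summits.Ventures.PercRepro2.Events
import Summits.Ventures.PercRepro2.Harris
import Summits.Ventures.PercRepro2.XWForm
import Summits.Ventures.PercRepro2.XWCycle

/-!
# Subgraph transport for the (XW) form (PercRepro2, p2 g24)

A graph embedding — an injective edge map `σ : E → E'` over an injective vertex map `φ` with
`ends' (σ e) = Sym2.map φ (ends e)` — carries the bilinear form of (XW) along once the weights
are extended by `0` off the image: **`xwBil_embed`**:
`xwBil ends s y o u p p = xwBil ends' (φ s) (φ y) (φ o) (φ u) (extend σ p 0) (extend σ p 0)`.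
The configurations of positive weight for the extended vector are closed off the image
(`weight_eq_zero_of_open_off`), on them connectivity is carried along `φ`
(`conn_ext_iff`, by `Relation.ReflTransGen` induction both ways), and the product weight is
reindexed (`weight_ext`).  Used to spread the `K₅` certificate `xw_k5` to every simple graph on
at most five vertices (`XWFiveVertices.lean`).  Own work; standard axioms.
-/

namespace Summit.Ventures.PercRepro2

namespace XWEmbed

section Transport

variable {V : Type*} {E : Type*} {V' : Type*} {E' : Type*} [Fintype E] [DecidableEq E]
  [Fintype E'] [DecidableEq E'] {R : Type*} [CommRing R]

/-- A configuration extended by `false` off the image of the edge map. -/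
noncomputable def ext (σ : E → E') (ω : Config E) : Config E' :=
  Function.extend σ ω (fun _ => false)

/-- The extended weight vector: `p` on the image, `0` off it. -/
noncomputable def extW (σ : E → E') (p : E → R) : E' → R := Function.extend σ p (fun _ => 0)

omit [Fintype E] [DecidableEq E] [Fintype E'] [DecidableEq E'] in
/-- The extension at an image edge. -/
lemma ext_apply {σ : E → E'} (hσ : Function.Injective σ) (ω : Config E) (e : E) :
    ext σ ω (σ e) = ω e :=
  hσ.extend_apply ω (fun _ => false) e

omit [Fintype E] [DecidableEq E] [Fintype E'] [DecidableEq E'] in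
/-- The extension off the image. -/
lemma ext_apply' (σ : E → E') (ω : Config E) {f : E'} (hf : ¬ ∃ e, σ e = f) :
    ext σ ω f = false :=
  Function.extend_apply' ω (fun _ => false) f hf

omit [Fintype E] [DecidableEq E] [Fintype E'] [DecidableEq E'] in
/-- The extended weight at an image edge. -/
lemma extW_apply {σ : E → E'} (hσ : Function.Injective σ) (p : E → R) (e : E) :
    extW σ p (σ e) = p e :=
  hσ.extend_apply p (fun _ => 0) e

omit [Fintype E] [DecidableEq E] [Fintype E'] [DecidableEq E'] in
/-- The extended weight off the image. -/
lemma extW_apply' (σ : E → E') (p : E → R) {f : E'} (hf : ¬ ∃ e, σ e = f) : extW σ p f = 0 :=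
  Function.extend_apply' p (fun _ => (0 : R)) f hf

omit [Fintype E] [DecidableEq E] [Fintype E'] [DecidableEq E'] in
/-- Restricting the extension gives the configuration back. -/
lemma comp_ext {σ : E → E'} (hσ : Function.Injective σ) (ω : Config E) : ext σ ω ∘ σ = ω := by
  funext e
  exact ext_apply hσ ω e

/-- A configuration closed off the image is the extension of its restriction. -/
def Closed (σ : E → E') (ω' : Config E') : Prop := ∀ f, (¬ ∃ e, σ e = f) → ω' f = false

omit [Fintype E] [DecidableEq E] [Fintype E'] [DecidableEq E'] in
/-- The extension is closed off the image. -/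
lemma closed_ext (σ : E → E') (ω : Config E) : Closed σ (ext σ ω) :=
  fun _ hf => ext_apply' σ ω hf

omit [Fintype E] [DecidableEq E] [Fintype E'] [DecidableEq E'] in
/-- A closed configuration is the extension of its restriction. -/
lemma ext_comp {σ : E → E'} (hσ : Function.Injective σ) {ω' : Config E'} (h : Closed σ ω') :
    ext σ (ω' ∘ σ) = ω' := by
  funext f
  by_cases hf : ∃ e, σ e = f
  · obtain ⟨e, rfl⟩ := hf
    exact ext_apply hσ _ e
  · rw [ext_apply' σ _ hf, h f hf]

omit [DecidableEq E] in
/-- **The product weight is reindexed along the embedding.** -/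
lemma weight_ext {σ : E → E'} (hσ : Function.Injective σ) (p : E → R) (ω : Config E) :
    weight (extW σ p) (ext σ ω) = weight p ω := by
  unfold weight
  rw [← Finset.prod_subset (Finset.subset_univ (Finset.univ.image σ)) (fun f _ hf => ?_),
    Finset.prod_image (fun e _ e' _ h => hσ h)]
  · refine Finset.prod_congr rfl fun e _ => ?_
    rw [extW_apply hσ, ext_apply hσ]
  · have hf' : ¬ ∃ e, σ e = f := fun ⟨e, he⟩ => hf (Finset.mem_image.2 ⟨e, Finset.mem_univ _, he⟩)
    rw [extW_apply' σ p hf', ext_apply' σ ω hf']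
    simp [edgeFactor]

omit [Fintype E] [DecidableEq E] [DecidableEq E'] in
/-- A configuration open somewhere off the image has weight `0`. -/
lemma weight_eq_zero_of_open_off (σ : E → E') (p : E → R) {ω' : Config E'}
    (h : ¬ Closed σ ω') : weight (extW σ p) ω' = 0 := by
  unfold Closed at h
  simp only [not_forall] at h
  obtain ⟨f, hf, hopen⟩ := h
  have h1 : extW σ p f = 0 := extW_apply' σ p hf
  have h2 : ω' f = true := by
    cases hw : ω' f
    · exact absurd hw hopen
    · rfl
  unfold weight
  refine Finset.prod_eq_zero (Finset.mem_univ f) ?_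
  rw [h1, h2]
  simp [edgeFactor]

/-- **Probabilities are carried along the embedding**: `P_p(A) = P_{p'}((· ∘ σ)⁻¹ A)`. -/
lemma prob_ext {σ : E → E'} (hσ : Function.Injective σ) (p : E → R) (A : Set (Config E)) :
    prob p A = prob (extW σ p) ((fun ω' : Config E' => ω' ∘ σ) ⁻¹' A) := by
  classical
  unfold prob
  set G : Finset (Config E') := Finset.univ.filter (fun ω' => Closed σ ω') with hG
  have hzero : ∀ ω' ∈ Finset.univ, ω' ∉ G →
      ((fun ω' : Config E' => ω' ∘ σ) ⁻¹' A).indicator (weight (extW σ p)) ω' = 0 := by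
    intro ω' _ hω'
    have hc : ¬ Closed σ ω' := fun h => hω' (Finset.mem_filter.2 ⟨Finset.mem_univ _, h⟩)
    rw [Set.indicator_apply]
    split_ifs
    · exact weight_eq_zero_of_open_off σ p hc
    · rfl
  rw [← Finset.sum_subset (Finset.subset_univ G) hzero]
  refine Finset.sum_nbij' (ext σ) (fun ω' => ω' ∘ σ) ?_ ?_ ?_ ?_ ?_
  · intro ω _
    exact Finset.mem_coe.2 (Finset.mem_filter.2 ⟨Finset.mem_univ _, closed_ext σ ω⟩)
  · intro ω' _
    exact Finset.mem_coe.2 (Finset.mem_univ _)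
  · intro ω _
    exact comp_ext hσ ω
  · intro ω' hω'
    exact ext_comp hσ (Finset.mem_filter.1 (Finset.mem_coe.1 hω')).2
  · intro ω _
    rw [Set.indicator_apply, Set.indicator_apply, Set.mem_preimage, comp_ext hσ, weight_ext hσ]

omit [Fintype E] [DecidableEq E] [Fintype E'] [DecidableEq E'] in
/-- Open adjacency is carried along the embedding. -/
lemma openAdj_ext {ends : E → Sym2 V} {ends' : E' → Sym2 V'} {σ : E → E'} {φ : V → V'}
    (hcomp : ∀ e, ends' (σ e) = Sym2.map φ (ends e)) {ω' : Config E'} (a b : V)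
    (h : OpenAdj ends (ω' ∘ σ) a b) : OpenAdj ends' ω' (φ a) (φ b) := by
  obtain ⟨e, he, hends⟩ := h
  exact ⟨σ e, he, by rw [hcomp, hends, Sym2.map_mk]⟩

omit [Fintype E] [DecidableEq E] [Fintype E'] [DecidableEq E'] in
/-- An image of a pair under an injective map equal to `s(φ a, b')` forces `b'` into the image. -/
lemma map_eq_pair {φ : V → V'} (hφ : Function.Injective φ) (z : Sym2 V) {a : V} {b' : V'}
    (h : Sym2.map φ z = s(φ a, b')) : ∃ b, b' = φ b ∧ z = s(a, b) := by
  induction z using Sym2.ind with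
  | _ a₁ a₂ =>
    rw [Sym2.map_mk, Sym2.eq_iff] at h
    rcases h with ⟨h1, h2⟩ | ⟨h1, h2⟩
    · exact ⟨a₂, h2.symm, by rw [hφ h1]⟩
    · exact ⟨a₁, h1.symm, by rw [hφ h2, Sym2.eq_swap]⟩

omit [Fintype E] [DecidableEq E] [Fintype E'] [DecidableEq E'] in
/-- On a closed configuration, open adjacency from an image vertex stays in the image and is
carried back. -/
lemma openAdj_ext_back {ends : E → Sym2 V} {ends' : E' → Sym2 V'} {σ : E → E'} {φ : V → V'}
    (hφ : Function.Injective φ) (hcomp : ∀ e, ends' (σ e) = Sym2.map φ (ends e))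
    {ω' : Config E'} (hcl : Closed σ ω') (a : V) (b' : V')
    (h : OpenAdj ends' ω' (φ a) b') : ∃ b, b' = φ b ∧ OpenAdj ends (ω' ∘ σ) a b := by
  obtain ⟨f, hf, hends⟩ := h
  have hex : ∃ e, σ e = f := by
    by_contra hne
    rw [hcl f hne] at hf
    exact Bool.false_ne_true hf
  obtain ⟨e, rfl⟩ := hex
  rw [hcomp] at hends
  obtain ⟨b, hb, hz⟩ := map_eq_pair hφ (ends e) hends
  exact ⟨b, hb, e, hf, hz⟩

omit [Fintype E] [DecidableEq E] [Fintype E'] [DecidableEq E'] in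
/-- **Connectivity is carried along the embedding on closed configurations.** -/
lemma conn_ext_iff {ends : E → Sym2 V} {ends' : E' → Sym2 V'} {σ : E → E'} {φ : V → V'}
    (hφ : Function.Injective φ) (hcomp : ∀ e, ends' (σ e) = Sym2.map φ (ends e))
    {ω' : Config E'} (hcl : Closed σ ω') (x z : V) :
    Conn ends' ω' (φ x) (φ z) ↔ Conn ends (ω' ∘ σ) x z := by
  unfold Conn
  rw [SimpleGraph.reachable_iff_reflTransGen, SimpleGraph.reachable_iff_reflTransGen]
  constructor
  · intro h
    have key : ∀ b', Relation.ReflTransGen (openGraph ends' ω').Adj (φ x) b' →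
        ∃ b, b' = φ b ∧ Relation.ReflTransGen (openGraph ends (ω' ∘ σ)).Adj x b := by
      intro b' hb'
      induction hb' with
      | refl => exact ⟨x, rfl, Relation.ReflTransGen.refl⟩
      | tail _ hadj ih =>
        obtain ⟨b, rfl, hb⟩ := ih
        rw [openGraph_adj] at hadj
        obtain ⟨c, rfl, hc⟩ := openAdj_ext_back hφ hcomp hcl b _ hadj.2
        refine ⟨c, rfl, Relation.ReflTransGen.tail hb ?_⟩
        rw [openGraph_adj]
        exact ⟨fun h => hadj.1 (by rw [h]), hc⟩
    obtain ⟨b, hb, hconn⟩ := key _ h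
    rw [hφ hb]
    exact hconn
  · intro h
    induction h with
    | refl => exact Relation.ReflTransGen.refl
    | tail _ hadj ih =>
      refine Relation.ReflTransGen.tail ih ?_
      rw [openGraph_adj] at hadj ⊢
      exact ⟨fun h => hadj.1 (hφ h), openAdj_ext hcomp _ _ hadj.2⟩

omit [Fintype E] [DecidableEq E] in
/-- Two events agreeing on the closed configurations have the same extended probability. -/
lemma prob_congr_closed (σ : E → E') (p : E → R) {A B : Set (Config E')}
    (h : ∀ ω', Closed σ ω' → (ω' ∈ A ↔ ω' ∈ B)) : prob (extW σ p) A = prob (extW σ p) B := by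
  classical
  unfold prob
  refine Finset.sum_congr rfl fun ω' _ => ?_
  by_cases hc : Closed σ ω'
  · by_cases hA : ω' ∈ A
    · rw [Set.indicator_of_mem hA, Set.indicator_of_mem ((h ω' hc).1 hA)]
    · rw [Set.indicator_of_notMem hA, Set.indicator_of_notMem (fun hB => hA ((h ω' hc).2 hB))]
  · rw [Set.indicator_apply, Set.indicator_apply]
    split_ifs <;> simp [weight_eq_zero_of_open_off σ p hc]

omit [Fintype E] [DecidableEq E] in
/-- The preimage of a connection event agrees with the connection event of the images on the
closed configurations. -/
lemma connEvent_ext {ends : E → Sym2 V} {ends' : E' → Sym2 V'} {σ : E → E'} {φ : V → V'}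
    (hφ : Function.Injective φ) (hcomp : ∀ e, ends' (σ e) = Sym2.map φ (ends e)) (p : E → R)
    (x z : V) :
    prob (extW σ p) ((fun ω' : Config E' => ω' ∘ σ) ⁻¹' connEvent ends x z) =
      prob (extW σ p) (connEvent ends' (φ x) (φ z)) :=
  prob_congr_closed σ p fun ω' hcl => by
    simp only [Set.mem_preimage, connEvent, Set.mem_setOf_eq]
    exact (conn_ext_iff hφ hcomp hcl x z).symm

/-- **Subgraph transport for `B_W`**: along a graph embedding `(σ, φ)`, with the weights
extended by `0` off the image. -/
theorem xwBil_embed {ends : E → Sym2 V} {ends' : E' → Sym2 V'} {σ : E → E'} {φ : V → V'}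
    (hσ : Function.Injective σ) (hφ : Function.Injective φ)
    (hcomp : ∀ e, ends' (σ e) = Sym2.map φ (ends e)) (p : E → R) (s y o u : V) :
    xwBil ends s y o u p p = xwBil ends' (φ s) (φ y) (φ o) (φ u) (extW σ p) (extW σ p) := by
  have h2 : ∀ a b c d : V, prob p (connEvent ends a b ∩ connEvent ends c d) =
      prob (extW σ p) (connEvent ends' (φ a) (φ b) ∩ connEvent ends' (φ c) (φ d)) := by
    intro a b c d
    rw [prob_ext hσ]
    refine prob_congr_closed σ p fun ω' hcl => ?_
    simp only [Set.mem_preimage, Set.mem_inter_iff, connEvent, Set.mem_setOf_eq]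
    rw [conn_ext_iff hφ hcomp hcl, conn_ext_iff hφ hcomp hcl]
  have h3 : ∀ a b c d g k : V,
      prob p (connEvent ends a b ∩ connEvent ends c d ∩ connEvent ends g k) =
      prob (extW σ p) (connEvent ends' (φ a) (φ b) ∩ connEvent ends' (φ c) (φ d) ∩
        connEvent ends' (φ g) (φ k)) := by
    intro a b c d g k
    rw [prob_ext hσ]
    refine prob_congr_closed σ p fun ω' hcl => ?_
    simp only [Set.mem_preimage, Set.mem_inter_iff, connEvent, Set.mem_setOf_eq]
    rw [conn_ext_iff hφ hcomp hcl, conn_ext_iff hφ hcomp hcl, conn_ext_iff hφ hcomp hcl]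
  have h1 : ∀ a b : V, prob p (connEvent ends a b) =
      prob (extW σ p) (connEvent ends' (φ a) (φ b)) := by
    intro a b
    rw [prob_ext hσ, connEvent_ext hφ hcomp]
  unfold xwBil
  rw [h2, h2, h2, h1, h1, h1, h3]

omit [DecidableEq E] [Fintype E'] in
/-- The extended weight vector is admissible. -/
lemma isProbVec_extW [LinearOrder R] [IsStrictOrderedRing R] {σ : E → E'}
    (hσ : Function.Injective σ) {p : E → R} (hp : IsProbVec p) : IsProbVec (extW σ p) where
  nonneg f := by
    by_cases hf : ∃ e, σ e = f
    · obtain ⟨e, rfl⟩ := hf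
      rw [extW_apply hσ]
      exact hp.nonneg e
    · rw [extW_apply' σ p hf]
  le_one f := by
    by_cases hf : ∃ e, σ e = f
    · obtain ⟨e, rfl⟩ := hf
      rw [extW_apply hσ]
      exact hp.le_one e
    · rw [extW_apply' σ p hf]
      exact zero_le_one

end Transport

end XWEmbed

end Summit.Ventures.PercRepro2
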